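import Mathlib
import Summits.AtomisticToContinuum.HydrodynamicLimit.Theorems.ImplosionDichotomyDenseExcursionSonicCavityDefs

/-!
# A weighted (L¹-smallness) Levinson lemma for `2 × 2` systems
# (crux `DenseExcursion`, line `sonic-cavity-renewal`, brick for `centreContent_of_tube`)

Helper file (`--supports stmt-AtomisticToContinuum-12586`, line lead a2, stub-worker W3 for `centreContent_of_tube`).

The landed effective Levinson lemma `levinson_fast_bound` (`…SonicConfinementLevinson`) measures the coupling of the
triangular-interaction system `u′ = α w`, `w′ = q w + β u` by SUP norms: `‖(β/q)′‖ ≤ L`, `‖β‖/|q| ≤ B/ω`, and pays the length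
`b − a` of the interval. On the bulk `[log(C₀/|Λ|), x_m]` of the centre problem the interval has length `∼ log |Λ|` while the
coupling `κ/|q| ∼ s₀ e^{−x}/(2|Im Λ|)` is only INTEGRABLY small (its integral is `∼ s₀/(2C₀)`), and the relative growth
`Re (Q x − Q y)` of the fast family is not bounded by a constant times the coupling scale. This file re-proves the lemma with

* user-supplied MAJORANT PRIMITIVES `Φ₂`, `Φ₃` (`Φ₂′ ≥ ‖(β/q)′‖`, `Φ₃′ ≥ ‖β/q‖·‖α‖`) instead of sup bounds × length, and
* a user-supplied GROWTH MAJORANT `𝔊` (`Re (Q x − Q y) ≤ 𝔊 x − 𝔊 y` for `y ≤ x`, `𝔊 a ≤ 𝔊`) with the fast variable measured in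
  the normalised size `e^{𝔊 a − 𝔊 x}‖w x‖ ≤ V` — so that conversion created at `y` and amplified by `e^{𝔊 x − 𝔊 y}` up to `x`
  costs `Φ₃′(y)·V`, not `e^{sup 𝔊}·Φ₃′(y)·V`:

`levinson_weighted_fast` (registered helper): `‖w x − e^{Q x − Q a} w a‖ ≤ ε₁(x) U + e^{𝔊 x − 𝔊 a}(ε₁(a) U + (Φ₂ x − Φ₂ a) U + (Φ₃ x − Φ₃ a) V)`;
`levinson_weighted_sup`: the bootstrap `sup e^{𝔊 a − 𝔊 x}‖w x‖ ≤ (‖w a‖ + (2E₁ + Φ₂ b − Φ₂ a) U)/(1 − (Φ₃ b − Φ₃ a))`;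
`levinson_weighted_slow`: the slow variable after one integration by parts, `H = u − (α/q) w`, `H′ = −(α/q)′ w − (αβ/q) u`,
`‖H x − H y‖ ≤ (Ψ₂ x − Ψ₂ y) V + (Ψ₃ x − Ψ₃ y) U`.
All three are the mean value inequality with a boundary function (`image_norm_le_of_norm_deriv_right_le_deriv_boundary'`).

Sources: Coppel 1965 Ch. IV; Eastham 1989 Thm 1.3.1 (no citation is load-bearing).
-/

noncomputable section

open Set

namespace Summit.AtomisticToContinuum.HydrodynamicLimit.Theorems.SonicCavityRenewal

/-- MEAN VALUE INEQUALITY WITH A MAJORANT PRIMITIVE: if `‖f′‖ ≤ φ = Φ′` on `[a, b]` then `‖f x − f a‖ ≤ Φ x − Φ a` there.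
[folklore] -/
theorem norm_sub_le_of_deriv_le_deriv {E : Type*} [NormedAddCommGroup E] [NormedSpace ℝ E] {a b : ℝ} {f f' : ℝ → E}
    {Φ φ : ℝ → ℝ} (hf : ∀ y ∈ Icc a b, HasDerivAt f (f' y) y) (hΦ : ∀ y ∈ Icc a b, HasDerivAt Φ (φ y) y)
    (hb : ∀ y ∈ Icc a b, ‖f' y‖ ≤ φ y) : ∀ x ∈ Icc a b, ‖f x - f a‖ ≤ Φ x - Φ a := by
  intro x hx
  have hfc : ContinuousOn (fun y => f y - f a) (Icc a b) :=
    (fun y hy => (hf y hy).continuousAt.continuousWithinAt.sub continuousWithinAt_const)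
  have hΦc : ContinuousOn (fun y => Φ y - Φ a) (Icc a b) :=
    (fun y hy => (hΦ y hy).continuousAt.continuousWithinAt.sub continuousWithinAt_const)
  have key := image_norm_le_of_norm_deriv_right_le_deriv_boundary' (f := fun y => f y - f a) (f' := f') (a := a) (b := b)
    hfc (fun y hy => ((hf y (Ico_subset_Icc_self hy)).sub_const (f a)).hasDerivWithinAt)
    (B := fun y => Φ y - Φ a) (B' := φ) (by simp) hΦc
    (fun y hy => ((hΦ y (Ico_subset_Icc_self hy)).sub_const (Φ a)).hasDerivWithinAt)
    (fun y hy => hb y (Ico_subset_Icc_self hy)) hx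
  simpa using key

/-- **WEIGHTED LEVINSON LEMMA, FAST COMPONENT** — registered helper `levinson_weighted_fast` for `centreContent_of_tube`.
For `u′ = α w`, `w′ = q w + β u` on `[a, b]` with `Q′ = q ≠ 0`, a growth majorant `𝔊` (`Re (Q x − Q y) ≤ 𝔊 x − 𝔊 y` for
`a ≤ y ≤ x ≤ b`, `𝔊 a ≤ 𝔊 y`), a pointwise bound `‖β/q‖ ≤ ε₁`, majorant primitives `Φ₂′ = φ₂ ≥ ‖(β/q)′‖`,
`Φ₃′ = φ₃ ≥ ‖β/q‖‖α‖`, `‖u‖ ≤ U` and the NORMALISED fast size `‖w y‖ ≤ e^{𝔊 y − 𝔊 a} V`: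
`‖w x − e^{Q x − Q a} w a‖ ≤ ε₁(x) U + e^{𝔊 x − 𝔊 a}(ε₁(a) U + (Φ₂ x − Φ₂ a) U + (Φ₃ x − Φ₃ a) V)`.
One integration by parts on `G(y) = e^{Q x − Q y}(w + (β/q)u)(y)`, `G′ = e^{Q x − Q y}((β/q)′u + (β/q)αw)`. [folklore] -/
theorem levinson_weighted_fast : ∀ (a b : ℝ) (u w α β q Q ρ' : ℝ → ℂ) (𝔊 ε₁ Φ₂ φ₂ Φ₃ φ₃ : ℝ → ℝ) (U V : ℝ), (∀ x ∈ Set.Icc a b, HasDerivAt u (α x * w x) x) → (∀ x ∈ Set.Icc a b, HasDerivAt w (q x * w x + β x * u x) x) → (∀ x ∈ Set.Icc a b, HasDerivAt Q (q x) x) → (∀ x ∈ Set.Icc a b, HasDerivAt (fun y => β y / q y) (ρ' x) x) → (∀ x ∈ Set.Icc a b, q x ≠ 0) → (∀ x ∈ Set.Icc a b, ∀ y ∈ Set.Icc a x, (Q x - Q y).re ≤ 𝔊 x - 𝔊 y) → (∀ x ∈ Set.Icc a b, 𝔊 a ≤ 𝔊 x) → (∀ x ∈ Set.Icc a b, ‖β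 x / q x‖ ≤ ε₁ x) → (∀ x ∈ Set.Icc a b, HasDerivAt Φ₂ (φ₂ x) x) → (∀ x ∈ Set.Icc a b, ‖ρ' x‖ ≤ φ₂ x) → (∀ x ∈ Set.Icc a b, HasDerivAt Φ₃ (φ₃ x) x) → (∀ x ∈ Set.Icc a b, ‖β x / q x‖ * ‖α x‖ ≤ φ₃ x) → (∀ x ∈ Set.Icc a b, ‖u x‖ ≤ U) → (∀ x ∈ Set.Icc a b, ‖w x‖ ≤ Real.exp (𝔊 x - 𝔊 a) * V) → ∀ x ∈ Set.Icc a b, ‖w x - Complex.exp (Q x - Q a) * w a‖ ≤ ε₁ x * U + Real.exp (𝔊 x - 𝔊 a) * (ε₁ a * U + (Φ₂ x - Φ₂ a) * U + (Φ₃ x - Φ₃ a) * V) := by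
  intro a b u w α β q Q ρ' 𝔊 ε₁ Φ₂ φ₂ Φ₃ φ₃ U V hu hw hQ hρ hq h𝔊 h𝔊a hε₁ hΦ₂ hφ₂ hΦ₃ hφ₃ hU hV x hx
  have ha : a ∈ Icc a b := left_mem_Icc.2 (hx.1.trans hx.2)
  -- signs
  have hU0 : 0 ≤ U := (norm_nonneg _).trans (hU x hx)
  have hV0 : 0 ≤ V := by
    have h := hV a ha
    rw [sub_self, Real.exp_zero, one_mul] at h
    exact (norm_nonneg _).trans h
  have hexp : ∀ y ∈ Icc a x, ‖Complex.exp (Q x - Q y)‖ ≤ Real.exp (𝔊 x - 𝔊 y) := by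
    intro y hy
    rw [Complex.norm_exp]
    exact Real.exp_le_exp.2 (h𝔊 x hx y hy)
  -- the gauge function `G` and its derivative (the O(1) terms cancel)
  set G : ℝ → ℂ := fun y => Complex.exp (Q x - Q y) * (w y + β y / q y * u y) with hG
  have hGd : ∀ y ∈ Icc a x,
      HasDerivAt G (Complex.exp (Q x - Q y) * (ρ' y * u y + β y / q y * (α y * w y))) y := by
    intro y hy
    have hy' : y ∈ Icc a b := ⟨hy.1, hy.2.trans hx.2⟩
    have h1 : HasDerivAt (fun z => Complex.exp (Q x - Q z)) (Complex.exp (Q x - Q y) * (0 - q y)) y :=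
      ((hasDerivAt_const y (Q x)).sub (hQ y hy')).cexp
    have h2 : HasDerivAt (fun z => w z + β z / q z * u z)
        (q y * w y + β y * u y + (ρ' y * u y + β y / q y * (α y * w y))) y :=
      (hw y hy').add ((hρ y hy').mul (hu y hy'))
    have hβq' : β y / q y * q y = β y := div_mul_cancel₀ (β y) (hq y hy')
    refine (h1.mul h2).congr_deriv ?_
    linear_combination (-(Complex.exp (Q x - Q y) * u y)) * hβq'
  -- pointwise bound on `G′` by the derivative of the boundary function
  have hbound : ∀ y ∈ Icc a x,
      ‖Complex.exp (Q x - Q y) * (ρ' y * u y + β y / q y * (α y * w y))‖ ≤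
        Real.exp (𝔊 x - 𝔊 a) * (φ₂ y * U + φ₃ y * V) := by
    intro y hy
    have hy' : y ∈ Icc a b := ⟨hy.1, hy.2.trans hx.2⟩
    have hφ₂0 : 0 ≤ φ₂ y := (norm_nonneg _).trans (hφ₂ y hy')
    have hga : 𝔊 a ≤ 𝔊 y := h𝔊a y hy'
    have he1 : Real.exp (𝔊 x - 𝔊 y) ≤ Real.exp (𝔊 x - 𝔊 a) := Real.exp_le_exp.2 (by linarith)
    have he2 : Real.exp (𝔊 x - 𝔊 y) * Real.exp (𝔊 y - 𝔊 a) = Real.exp (𝔊 x - 𝔊 a) := by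
      rw [← Real.exp_add]; congr 1; ring
    calc ‖Complex.exp (Q x - Q y) * (ρ' y * u y + β y / q y * (α y * w y))‖
        ≤ ‖Complex.exp (Q x - Q y)‖ * (‖ρ' y‖ * ‖u y‖ + ‖β y / q y‖ * (‖α y‖ * ‖w y‖)) := by
          rw [norm_mul]
          gcongr
          refine (norm_add_le _ _).trans ?_
          rw [norm_mul, norm_mul, norm_mul]
      _ ≤ Real.exp (𝔊 x - 𝔊 y) * (φ₂ y * U + ‖β y / q y‖ * ‖α y‖ * (Real.exp (𝔊 y - 𝔊 a) * V)) := by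
          have h3 : ‖ρ' y‖ * ‖u y‖ ≤ φ₂ y * U := mul_le_mul (hφ₂ y hy') (hU y hy') (norm_nonneg _) hφ₂0
          have h4 : ‖β y / q y‖ * (‖α y‖ * ‖w y‖) ≤ ‖β y / q y‖ * ‖α y‖ * (Real.exp (𝔊 y - 𝔊 a) * V) := by
            rw [mul_assoc]
            exact mul_le_mul_of_nonneg_left (mul_le_mul_of_nonneg_left (hV y hy') (norm_nonneg _)) (norm_nonneg _)
          exact mul_le_mul (hexp y hy) (add_le_add h3 h4) (by positivity) (by positivity)
      _ = Real.exp (𝔊 x - 𝔊 y) * (φ₂ y * U) + (‖β y / q y‖ * ‖α y‖) * (Real.exp (𝔊 x - 𝔊 a) * V) := by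
          rw [← he2]; ring
      _ ≤ Real.exp (𝔊 x - 𝔊 a) * (φ₂ y * U) + φ₃ y * (Real.exp (𝔊 x - 𝔊 a) * V) := by
          gcongr
          exact hφ₃ y hy'
      _ = Real.exp (𝔊 x - 𝔊 a) * (φ₂ y * U + φ₃ y * V) := by ring
  -- mean value inequality with the boundary function on `[a, x]`
  have hMVT := norm_sub_le_of_deriv_le_deriv (a := a) (b := x) (f := G)
    (Φ := fun y => Real.exp (𝔊 x - 𝔊 a) * (Φ₂ y * U + Φ₃ y * V))
    (φ := fun y => Real.exp (𝔊 x - 𝔊 a) * (φ₂ y * U + φ₃ y * V)) hGd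
    (fun y hy => (((hΦ₂ y ⟨hy.1, hy.2.trans hx.2⟩).mul_const U).add
      ((hΦ₃ y ⟨hy.1, hy.2.trans hx.2⟩).mul_const V)).const_mul _) hbound x (right_mem_Icc.2 hx.1)
  -- unpack `G x`, `G a`
  have hβq : ∀ y ∈ Icc a b, ‖β y / q y * u y‖ ≤ ε₁ y * U := by
    intro y hy
    rw [norm_mul]
    exact mul_le_mul (hε₁ y hy) (hU y hy) (norm_nonneg _) ((norm_nonneg _).trans (hε₁ y hy))
  have key : w x - Complex.exp (Q x - Q a) * w a =
      (G x - G a) - β x / q x * u x + Complex.exp (Q x - Q a) * (β a / q a * u a) := by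
    simp only [hG]
    rw [sub_self, Complex.exp_zero]
    ring
  have h5 : ‖β x / q x * u x‖ ≤ ε₁ x * U := hβq x hx
  have h6 : ‖Complex.exp (Q x - Q a) * (β a / q a * u a)‖ ≤ Real.exp (𝔊 x - 𝔊 a) * (ε₁ a * U) := by
    rw [norm_mul]
    exact mul_le_mul (hexp a (left_mem_Icc.2 hx.1)) (hβq a ha) (norm_nonneg _) (by positivity)
  calc ‖w x - Complex.exp (Q x - Q a) * w a‖
      = ‖(G x - G a) - β x / q x * u x + Complex.exp (Q x - Q a) * (β a / q a * u a)‖ := by rw [key]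
    _ ≤ ‖G x - G a‖ + ‖β x / q x * u x‖ + ‖Complex.exp (Q x - Q a) * (β a / q a * u a)‖ :=
        (norm_add_le _ _).trans (by gcongr; exact norm_sub_le _ _)
    _ ≤ (Real.exp (𝔊 x - 𝔊 a) * (Φ₂ x * U + Φ₃ x * V) - Real.exp (𝔊 x - 𝔊 a) * (Φ₂ a * U + Φ₃ a * V)) +
          ε₁ x * U + Real.exp (𝔊 x - 𝔊 a) * (ε₁ a * U) := add_le_add (add_le_add hMVT h5) h6
    _ = ε₁ x * U + Real.exp (𝔊 x - 𝔊 a) * (ε₁ a * U + (Φ₂ x - Φ₂ a) * U + (Φ₃ x - Φ₃ a) * V) := by ring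

/-- **WEIGHTED LEVINSON, BOOTSTRAP.** Under the hypotheses of `levinson_weighted_fast` WITHOUT an a priori bound on `w`, if
`𝔊` is continuous, `ε₁ ≤ E₁` and the integrated coupling is small, `Φ₃ b − Φ₃ a < 1`, then the normalised fast size is bounded
throughout: `e^{𝔊 a − 𝔊 x}‖w x‖ ≤ (‖w a‖ + (2E₁ + Φ₂ b − Φ₂ a) U)/(1 − (Φ₃ b − Φ₃ a))` (apply the fast bound at a point where
the continuous function `e^{𝔊 a − 𝔊 x}‖w x‖` is maximal on the compact interval). [folklore] -/
theorem levinson_weighted_sup {a b : ℝ} (hab : a ≤ b) {u w α β q Q ρ' : ℝ → ℂ} {𝔊 ε₁ Φ₂ φ₂ Φ₃ φ₃ : ℝ → ℝ} {U E₁ : ℝ}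
    (hu : ∀ x ∈ Icc a b, HasDerivAt u (α x * w x) x)
    (hw : ∀ x ∈ Icc a b, HasDerivAt w (q x * w x + β x * u x) x)
    (hQ : ∀ x ∈ Icc a b, HasDerivAt Q (q x) x)
    (hρ : ∀ x ∈ Icc a b, HasDerivAt (fun y => β y / q y) (ρ' x) x)
    (hq : ∀ x ∈ Icc a b, q x ≠ 0)
    (h𝔊 : ∀ x ∈ Icc a b, ∀ y ∈ Icc a x, (Q x - Q y).re ≤ 𝔊 x - 𝔊 y)
    (h𝔊a : ∀ x ∈ Icc a b, 𝔊 a ≤ 𝔊 x) (h𝔊c : ContinuousOn 𝔊 (Icc a b))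
    (hε₁ : ∀ x ∈ Icc a b, ‖β x / q x‖ ≤ ε₁ x) (hE₁ : ∀ x ∈ Icc a b, ε₁ x ≤ E₁)
    (hΦ₂ : ∀ x ∈ Icc a b, HasDerivAt Φ₂ (φ₂ x) x) (hφ₂ : ∀ x ∈ Icc a b, ‖ρ' x‖ ≤ φ₂ x)
    (hΦ₃ : ∀ x ∈ Icc a b, HasDerivAt Φ₃ (φ₃ x) x) (hφ₃ : ∀ x ∈ Icc a b, ‖β x / q x‖ * ‖α x‖ ≤ φ₃ x)
    (hU : ∀ x ∈ Icc a b, ‖u x‖ ≤ U) (hsmall : Φ₃ b - Φ₃ a < 1) :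
    ∀ x ∈ Icc a b, Real.exp (𝔊 a - 𝔊 x) * ‖w x‖ ≤
      (‖w a‖ + (2 * E₁ + (Φ₂ b - Φ₂ a)) * U) / (1 - (Φ₃ b - Φ₃ a)) := by
  have ha : a ∈ Icc a b := left_mem_Icc.2 hab
  have hb : b ∈ Icc a b := right_mem_Icc.2 hab
  have hU0 : 0 ≤ U := (norm_nonneg _).trans (hU a ha)
  -- monotonicity of the majorant primitives
  have hΦ₂m : MonotoneOn Φ₂ (Icc a b) :=
    monotoneOn_of_hasDerivWithinAt_nonneg (convex_Icc a b)
      (fun x hx => (hΦ₂ x hx).continuousAt.continuousWithinAt)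
      (fun x hx => (hΦ₂ x (interior_subset hx)).hasDerivWithinAt)
      fun x hx => (norm_nonneg _).trans (hφ₂ x (interior_subset hx))
  have hΦ₃m : MonotoneOn Φ₃ (Icc a b) :=
    monotoneOn_of_hasDerivWithinAt_nonneg (convex_Icc a b)
      (fun x hx => (hΦ₃ x hx).continuousAt.continuousWithinAt)
      (fun x hx => (hΦ₃ x (interior_subset hx)).hasDerivWithinAt)
      fun x hx => (mul_nonneg (norm_nonneg _) (norm_nonneg _)).trans (hφ₃ x (interior_subset hx))
  -- the normalised size attains its maximum `V` on the compact interval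
  have hcont : ContinuousOn (fun x => Real.exp (𝔊 a - 𝔊 x) * ‖w x‖) (Icc a b) :=
    (Real.continuous_exp.comp_continuousOn (continuousOn_const.sub h𝔊c)).mul
      (continuous_norm.comp_continuousOn fun x hx => (hw x hx).continuousAt.continuousWithinAt)
  obtain ⟨x₀, hx₀, hmax⟩ := isCompact_Icc.exists_isMaxOn (nonempty_Icc.2 hab) hcont
  set V := Real.exp (𝔊 a - 𝔊 x₀) * ‖w x₀‖ with hVdef
  have hV0 : 0 ≤ V := by positivity
  have hV : ∀ x ∈ Icc a b, ‖w x‖ ≤ Real.exp (𝔊 x - 𝔊 a) * V := by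
    intro x hx
    have h1 : Real.exp (𝔊 a - 𝔊 x) * ‖w x‖ ≤ V := hmax hx
    have h2 : Real.exp (𝔊 x - 𝔊 a) * (Real.exp (𝔊 a - 𝔊 x) * ‖w x‖) = ‖w x‖ := by
      rw [← mul_assoc, ← Real.exp_add, show 𝔊 x - 𝔊 a + (𝔊 a - 𝔊 x) = 0 by ring, Real.exp_zero, one_mul]
    calc ‖w x‖ = Real.exp (𝔊 x - 𝔊 a) * (Real.exp (𝔊 a - 𝔊 x) * ‖w x‖) := h2.symm
      _ ≤ Real.exp (𝔊 x - 𝔊 a) * V := mul_le_mul_of_nonneg_left h1 (Real.exp_pos _).le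
  -- the fast bound at the maximum point
  have hfast := levinson_weighted_fast a b u w α β q Q ρ' 𝔊 ε₁ Φ₂ φ₂ Φ₃ φ₃ U V hu hw hQ hρ hq h𝔊 h𝔊a hε₁ hΦ₂ hφ₂
    hΦ₃ hφ₃ hU hV x₀ hx₀
  have hE0 : 0 ≤ E₁ := ((norm_nonneg _).trans (hε₁ a ha)).trans (hE₁ a ha)
  have hexp0 : Real.exp (𝔊 a - 𝔊 x₀) ≤ 1 := Real.exp_le_one_iff.2 (by linarith [h𝔊a x₀ hx₀])
  have hinv : Real.exp (𝔊 a - 𝔊 x₀) * Real.exp (𝔊 x₀ - 𝔊 a) = 1 := by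
    rw [← Real.exp_add, show 𝔊 a - 𝔊 x₀ + (𝔊 x₀ - 𝔊 a) = 0 by ring, Real.exp_zero]
  have hwa : ‖Complex.exp (Q x₀ - Q a) * w a‖ ≤ Real.exp (𝔊 x₀ - 𝔊 a) * ‖w a‖ := by
    rw [norm_mul, Complex.norm_exp]
    exact mul_le_mul_of_nonneg_right (Real.exp_le_exp.2 (h𝔊 x₀ hx₀ a (left_mem_Icc.2 hx₀.1))) (norm_nonneg _)
  have hΦ₂le : Φ₂ x₀ - Φ₂ a ≤ Φ₂ b - Φ₂ a := by linarith [hΦ₂m hx₀ hb hx₀.2]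
  have hΦ₃le : Φ₃ x₀ - Φ₃ a ≤ Φ₃ b - Φ₃ a := by linarith [hΦ₃m hx₀ hb hx₀.2]
  have hΦ₂0 : 0 ≤ Φ₂ x₀ - Φ₂ a := by linarith [hΦ₂m ha hx₀ hx₀.1]
  have hΦ₃0 : 0 ≤ Φ₃ x₀ - Φ₃ a := by linarith [hΦ₃m ha hx₀ hx₀.1]
  -- `V ≤ ‖w a‖ + (2E₁ + ΔΦ₂) U + ΔΦ₃ V`
  have hVle : V ≤ ‖w a‖ + (2 * E₁ + (Φ₂ b - Φ₂ a)) * U + (Φ₃ b - Φ₃ a) * V := by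
    have h1 : ‖w x₀‖ ≤ ‖Complex.exp (Q x₀ - Q a) * w a‖ + ‖w x₀ - Complex.exp (Q x₀ - Q a) * w a‖ :=
      norm_le_norm_add_norm_sub' _ _
    have h2 : ‖w x₀‖ ≤ Real.exp (𝔊 x₀ - 𝔊 a) * ‖w a‖ + (ε₁ x₀ * U +
        Real.exp (𝔊 x₀ - 𝔊 a) * (ε₁ a * U + (Φ₂ x₀ - Φ₂ a) * U + (Φ₃ x₀ - Φ₃ a) * V)) := by
      linarith [h1, hwa, hfast]
    have h3 : V ≤ ‖w a‖ + Real.exp (𝔊 a - 𝔊 x₀) * (ε₁ x₀ * U) +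
        (ε₁ a * U + (Φ₂ x₀ - Φ₂ a) * U + (Φ₃ x₀ - Φ₃ a) * V) := by
      have h := mul_le_mul_of_nonneg_left h2 (Real.exp_pos (𝔊 a - 𝔊 x₀)).le
      rw [← hVdef] at h
      have e1 : Real.exp (𝔊 a - 𝔊 x₀) * (Real.exp (𝔊 x₀ - 𝔊 a) * ‖w a‖ + (ε₁ x₀ * U +
          Real.exp (𝔊 x₀ - 𝔊 a) * (ε₁ a * U + (Φ₂ x₀ - Φ₂ a) * U + (Φ₃ x₀ - Φ₃ a) * V))) =
          (Real.exp (𝔊 a - 𝔊 x₀) * Real.exp (𝔊 x₀ - 𝔊 a)) * ‖w a‖ +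
            Real.exp (𝔊 a - 𝔊 x₀) * (ε₁ x₀ * U) + (Real.exp (𝔊 a - 𝔊 x₀) * Real.exp (𝔊 x₀ - 𝔊 a)) *
              (ε₁ a * U + (Φ₂ x₀ - Φ₂ a) * U + (Φ₃ x₀ - Φ₃ a) * V) := by ring
      rw [e1, hinv, one_mul, one_mul] at h
      exact h
    have h4 : Real.exp (𝔊 a - 𝔊 x₀) * (ε₁ x₀ * U) ≤ E₁ * U := by
      have : ε₁ x₀ * U ≤ E₁ * U := mul_le_mul_of_nonneg_right (hE₁ x₀ hx₀) hU0
      have h0 : 0 ≤ ε₁ x₀ * U := mul_nonneg ((norm_nonneg _).trans (hε₁ x₀ hx₀)) hU0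
      nlinarith
    have h5 : ε₁ a * U ≤ E₁ * U := mul_le_mul_of_nonneg_right (hE₁ a ha) hU0
    have h6 : (Φ₂ x₀ - Φ₂ a) * U ≤ (Φ₂ b - Φ₂ a) * U := mul_le_mul_of_nonneg_right hΦ₂le hU0
    have h7 : (Φ₃ x₀ - Φ₃ a) * V ≤ (Φ₃ b - Φ₃ a) * V := mul_le_mul_of_nonneg_right hΦ₃le hV0
    linarith
  have hden : 0 < 1 - (Φ₃ b - Φ₃ a) := by linarith
  have hVbound : V ≤ (‖w a‖ + (2 * E₁ + (Φ₂ b - Φ₂ a)) * U) / (1 - (Φ₃ b - Φ₃ a)) := by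
    rw [le_div_iff₀ hden]
    nlinarith
  intro x hx
  exact (hmax hx).trans hVbound

/-- **WEIGHTED LEVINSON, SLOW COMPONENT** (one integration by parts on the slow equation). For `u′ = α w`, `w′ = q w + β u`,
`q ≠ 0`, the corrected slow variable `H = u − (α/q) w` satisfies `H′ = −(α/q)′ w − (αβ/q) u`; with majorant primitives
`Ψ₂′ = ψ₂ ≥ ‖(α/q)′‖·e^{𝔊 − 𝔊 a}`, `Ψ₃′ = ψ₃ ≥ ‖α/q‖·‖β‖`, `‖u‖ ≤ U`, `‖w y‖ ≤ e^{𝔊 y − 𝔊 a} V`: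
`‖H x − H y‖ ≤ (Ψ₂ x − Ψ₂ y) V + (Ψ₃ x − Ψ₃ y) U` for `a ≤ y ≤ x ≤ b`. [folklore] -/
theorem levinson_weighted_slow {a b : ℝ} {u w α β q σ' : ℝ → ℂ} {𝔊 Ψ₂ ψ₂ Ψ₃ ψ₃ : ℝ → ℝ} {U V : ℝ}
    (hu : ∀ x ∈ Icc a b, HasDerivAt u (α x * w x) x)
    (hw : ∀ x ∈ Icc a b, HasDerivAt w (q x * w x + β x * u x) x)
    (hq : ∀ x ∈ Icc a b, q x ≠ 0)
    (hσ : ∀ x ∈ Icc a b, HasDerivAt (fun y => α y / q y) (σ' x) x)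
    (hΨ₂ : ∀ x ∈ Icc a b, HasDerivAt Ψ₂ (ψ₂ x) x) (hψ₂ : ∀ x ∈ Icc a b, ‖σ' x‖ * Real.exp (𝔊 x - 𝔊 a) ≤ ψ₂ x)
    (hΨ₃ : ∀ x ∈ Icc a b, HasDerivAt Ψ₃ (ψ₃ x) x) (hψ₃ : ∀ x ∈ Icc a b, ‖α x / q x‖ * ‖β x‖ ≤ ψ₃ x)
    (hU : ∀ x ∈ Icc a b, ‖u x‖ ≤ U) (hV : ∀ x ∈ Icc a b, ‖w x‖ ≤ Real.exp (𝔊 x - 𝔊 a) * V) :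
    ∀ x ∈ Icc a b, ∀ y ∈ Icc a x,
      ‖(u x - α x / q x * w x) - (u y - α y / q y * w y)‖ ≤ (Ψ₂ x - Ψ₂ y) * V + (Ψ₃ x - Ψ₃ y) * U := by
  intro x hx y hy
  have hy' : y ∈ Icc a b := ⟨hy.1, hy.2.trans hx.2⟩
  have hU0 : 0 ≤ U := (norm_nonneg _).trans (hU x hx)
  have hV0 : 0 ≤ V := by
    have ha : a ∈ Icc a b := left_mem_Icc.2 (hx.1.trans hx.2)
    have h := hV a ha
    rw [sub_self, Real.exp_zero, one_mul] at h
    exact (norm_nonneg _).trans h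
  -- the corrected slow variable and its derivative
  set H : ℝ → ℂ := fun z => u z - α z / q z * w z with hH
  have hHd : ∀ z ∈ Icc y x, HasDerivAt H (-(σ' z * w z) - α z / q z * β z * u z) z := by
    intro z hz
    have hz' : z ∈ Icc a b := ⟨hy.1.trans hz.1, hz.2.trans hx.2⟩
    have h1 : HasDerivAt (fun t => α t / q t * w t) (σ' z * w z + α z / q z * (q z * w z + β z * u z)) z :=
      (hσ z hz').mul (hw z hz')
    have hαq : α z / q z * q z = α z := div_mul_cancel₀ (α z) (hq z hz')
    refine ((hu z hz').sub h1).congr_deriv ?_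
    linear_combination (-(w z)) * hαq
  have hbound : ∀ z ∈ Icc y x, ‖-(σ' z * w z) - α z / q z * β z * u z‖ ≤ ψ₂ z * V + ψ₃ z * U := by
    intro z hz
    have hz' : z ∈ Icc a b := ⟨hy.1.trans hz.1, hz.2.trans hx.2⟩
    calc ‖-(σ' z * w z) - α z / q z * β z * u z‖
        ≤ ‖σ' z * w z‖ + ‖α z / q z * β z * u z‖ := by
          refine (norm_sub_le _ _).trans ?_
          rw [norm_neg]
      _ = ‖σ' z‖ * ‖w z‖ + ‖α z / q z‖ * ‖β z‖ * ‖u z‖ := by rw [norm_mul, norm_mul, norm_mul]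
      _ ≤ ‖σ' z‖ * (Real.exp (𝔊 z - 𝔊 a) * V) + ‖α z / q z‖ * ‖β z‖ * U := by
          gcongr
          · exact hV z hz'
          · exact hU z hz'
      _ = (‖σ' z‖ * Real.exp (𝔊 z - 𝔊 a)) * V + (‖α z / q z‖ * ‖β z‖) * U := by ring
      _ ≤ ψ₂ z * V + ψ₃ z * U := by
          gcongr
          · exact hψ₂ z hz'
          · exact hψ₃ z hz'
  have hMVT := norm_sub_le_of_deriv_le_deriv (a := y) (b := x) (f := H) (Φ := fun z => Ψ₂ z * V + Ψ₃ z * U)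
    (φ := fun z => ψ₂ z * V + ψ₃ z * U) hHd
    (fun z hz => ((hΨ₂ z ⟨hy.1.trans hz.1, hz.2.trans hx.2⟩).mul_const V).add
      ((hΨ₃ z ⟨hy.1.trans hz.1, hz.2.trans hx.2⟩).mul_const U)) hbound x (right_mem_Icc.2 hy.2)
  calc ‖(u x - α x / q x * w x) - (u y - α y / q y * w y)‖ = ‖H x - H y‖ := rfl
    _ ≤ Ψ₂ x * V + Ψ₃ x * U - (Ψ₂ y * V + Ψ₃ y * U) := hMVT
    _ = (Ψ₂ x - Ψ₂ y) * V + (Ψ₃ x - Ψ₃ y) * U := by ring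

end Summit.AtomisticToContinuum.HydrodynamicLimit.Theorems.SonicCavityRenewal

end
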